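import Mathlib
import Summits.KontsevichZagierPeriods.Zeta5Search.ClusterValuationPairs
import Summits.KontsevichZagierPeriods.Zeta5Search.CellKitRays
import HarnessLib

/-!
# ζ(5) search — STATEMENT FILE: the p-adic cells of the OBSERVED staircase saving on the ten TOP_STAIR rays (DENOM-LAW track D1)

HONEST FRAMING: systematic search; no irrationality claim unless certified.  Cell `pub-zeta5`, track «DENOM-LAW» (coordinator
2026-08-23), D1 = the STAIRCASE THEOREM; this is its count-neutral statement file (seat `denom-prover-d1`): definitions of the rays
and the cells as NAMED `Prop`s (tagged `@[conjecture]` = OBSERVED laws minted by this cell, exact evidence quoted per cell), no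
theorem.  Proofs arrive in separate files (`StairTopFamily.lean`: the linear family through TOP_STAIR #1 and #9, all `n`).
Valuations of explicit rationals; every model exponent `γ` these cells feed is `< 1` — NO irrationality content; Brown–Zudilin's
records in print (0.86, and 0.86597135 conditional on their (28)) are UNMOVED.

## What the staircase saving is, p-adically (characterisation from the exact rows `n ≤ 40`)
For a direction `a` with dual ray `b = n·β` (`β = b(a)`, `WedgeDictionary`/`bOfA`), the constant term of the cellular form is
`P_n = ρ(b)·Cas₇(b)` (`Cas₇ = casoratian b 7 = W(b+e₇)V(b) − W(b)V(b+e₇)`, `7` = the index of the least parameter on all ten rays),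
and for an odd prime `p` in the one-digit range the accounting identity
  `v_p(Φ_n⁻¹ P_n) = μ_p − Σ_{j=1..7} ⌊b_j/p⌋ − ⌊d/p⌋ + v_p(Cas₇(b))`   (`d = 3b₀ − Σ b_j`, `μ_p` = Brown–Zudilin's group minimum of (29))
turns any denominator `D_n = ∏ d_{⌊m_i n⌋}` into a REQUIRED valuation `v_p(Cas₇(b)) ≥ ν_p − v_p(D_n) − ord_p ρ(b)` prime by prime.
The census's OBSERVED staircase multiset `δ_stair` (gen-2 g5 `halflaw.multiset_stair`; REPORT-gen2-g5 §4–§5d) is smaller than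
Brown–Zudilin's (28) multiset `δ_28` on 9 of the 10 TOP_STAIR rays; the lane's exact prime-by-prime audit (`ttrl/zeta5-calc/LADDER.md`,
`audit/final/profile_<a>.json`, two implementations, 0 violations) locates EVERY prime `p` of Brown–Zudilin's `Φ`-range `p² > m₁n`,
`n ≤ 40`, at which `v_p(D^stair_n) < v_p(D^(28)_n)` ('the stair bites': 2,981 primes on the ten rays) inside one, two or three LEVEL
CELLS `θ = p/n ∈ (ℓ, ℓ')` per ray (below), with a CONSTANT required bound `v_p(Cas₇(n·β)) ≥ c` on each cell (work log
`HOME/denom-law/prover-d1/ATTEMPT-1.md`, scripts `bites.py`, `bites2.py`).  At every one of these 2,981 bite primes the required bound is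
ALREADY the value of a PROVED class law of the tree evaluated on the class data of `(n·β, p)`: THEOREM LB `casLB` (rung M) on 15 cells
(2,359 primes), the Lemma-D bonus `casLB + 1` (rung J) on 4 cells (496), the double-drop bonus `casLB + 2` (rung B) on 1 cell (126) —
and the true valuation ATTAINS the bound at 2,973 of them (slack 1 at the other 8).  So the staircase saving IS the class laws at the top levels; what an all-`n`
theorem needs per cell is only the scale-free evaluation of the class data (a class-type cover, p3 g6's machine).  The cells are
stated with strict windows `ℓn < p < ℓ'n` (the finitely many `n = 1` endpoint primes are immaterial to the accounting).

Below: `c` = required bound, `[rung]` = the tree law that gives it pointwise, `k/K` = bite primes with `n ≤ 40` / of them attained.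
-/

namespace Summit.KontsevichZagierPeriods.Zeta5Search.StaircaseCells

open Summit.KontsevichZagierPeriods.Zeta5Search.CasoratianValuation (casoratian)
open Summit.KontsevichZagierPeriods.Zeta5Search.CellKit (bLin)

/-! ## §1 The rays -/

/-- **The TOP linear family** `bTop s n = n·(3s+16; s+8, s+7, …, s+2) = bLin ((s+2)n) (sn) n`: with `t = s + 2` the dual ray of the
diagonal translates `a_t = (7,13,9,12,11,15,17,12) + (t−8)·(1,…,1)`; `s = 6` is TOP_STAIR #1, `s = 7` is TOP_STAIR #9. -/
def bTop (s n : ℕ) : ℕ → ℤ := bLin (s * n + 2 * n) (s * n) n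

/-- An explicit ray `n·c` from a coefficient list `c = [c₀, c₁, …, c₇]`. -/
def bRay (c : List ℕ) (n : ℕ) : ℕ → ℤ := fun i => ((n * c.getD i 0 : ℕ) : ℤ)

/-- TOP_STAIR #2: `a = (8,17,11,16,13,18,22,14)`, `β = (44; 19,17,16,15,14,12,10)`, `δ_28 = 98`, `δ_stair = 96`. -/
def ts2 : List ℕ := [44, 19, 17, 16, 15, 14, 12, 10]
/-- TOP_STAIR #3: `a = (18,32,23,30,28,38,43,30)`, `β = (85; 35,32,30,27,25,22,20)`, `δ_28 = 195`, `δ_stair = 191`. -/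
def ts3 : List ℕ := [85, 35, 32, 30, 27, 25, 22, 20]
/-- TOP_STAIR #4: `a = (11,21,14,20,18,24,27,19)`, `β = (55; 23,21,20,17,16,15,13)`, `δ_28 = 125`, `δ_stair = 122`. -/
def ts4 : List ℕ := [55, 23, 21, 20, 17, 16, 15, 13]
/-- TOP_STAIR #5: `a = (11,19,14,18,17,23,26,18)`, `β = (51; 21,19,18,16,15,13,12)`, `δ_28 = 118`, `δ_stair = 115`. -/
def ts5 : List ℕ := [51, 21, 19, 18, 16, 15, 13, 12]
/-- TOP_STAIR #6: `a = (11,21,14,20,17,24,27,19)`, `β = (55; 23,21,20,18,16,15,13)`, `δ_28 = 124`, `δ_stair = 122`. -/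
def ts6 : List ℕ := [55, 23, 21, 20, 18, 16, 15, 13]
/-- TOP_STAIR #7: `a = (19,32,23,30,28,38,43,30)`, `β = (85; 34,32,30,27,25,22,20)`, `δ_28 = 195`, `δ_stair = 190`. -/
def ts7 : List ℕ := [85, 34, 32, 30, 27, 25, 22, 20]
/-- TOP_STAIR #8: `a = (10,16,12,15,14,19,22,15)`, `β = (43; 17,16,15,14,13,11,10)`, `δ_28 = 98`, `δ_stair = 96`. -/
def ts8 : List ℕ := [43, 17, 16, 15, 14, 13, 11, 10]
/-- TOP_STAIR #10: `a = (18,32,23,30,28,38,44,30)`, `β = (85; 35,32,30,27,25,22,19)`, `δ_28 = 198`, `δ_stair = 194`. -/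
def ts10 : List ℕ := [85, 35, 32, 30, 27, 25, 22, 19]

/-! ## §2 The linear family and TOP_STAIR #1, #9 (`δ_28 − δ_stair = 1`: one cell, charge 3 instead of 4 at level `t+7`) -/

/-- **FAMILY CELL** (all `s ≥ 2`): on `(s+8)n < p < (s+9)n` the staircase needs `v_p(Cas₇(bTop s n)) ≥ −3` [(28)+(30): `−4`]; [rung M:
`casLB = −3` on the whole cell, checked for `s ≤ 25`, `n ≤ 16`].  PROVED for all `s ≥ 2`, `n ≥ 1` in `StairTopFamily.lean`. -/
@[conjecture] def StairTopFamilyCell : Prop :=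
  ∀ s n p : ℕ, 2 ≤ s → 1 ≤ n → p.Prime → s * n + 8 * n < p → p < s * n + 9 * n → casoratian (bTop s n) 7 ≠ 0 →
    (-3 : ℤ) ≤ padicValRat p (casoratian (bTop s n) 7)

/-- **TS1** `a = (7,13,9,12,11,15,17,12)`, `β = (34;14,…,8) = bTop 6`: cell `(14,15)`, `c = −3` [M; 136/136]. -/
@[conjecture] def StairCellTS1 : Prop :=
  ∀ n p : ℕ, 1 ≤ n → p.Prime → 14 * n < p → p < 15 * n → casoratian (bTop 6 n) 7 ≠ 0 →
    (-3 : ℤ) ≤ padicValRat p (casoratian (bTop 6 n) 7)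

/-- **TS9** `a = (8,14,10,13,12,16,18,13)`, `β = (37;15,…,9) = bTop 7`: cell `(15,16)`, `c = −3` [M; 133/133]. -/
@[conjecture] def StairCellTS9 : Prop :=
  ∀ n p : ℕ, 1 ≤ n → p.Prime → 15 * n < p → p < 16 * n → casoratian (bTop 7 n) 7 ≠ 0 →
    (-3 : ℤ) ≤ padicValRat p (casoratian (bTop 7 n) 7)

/-! ## §3 The other eight TOP_STAIR rays -/

/-- **TS2a**: cell `(18,19)`, `c = −2` [M; 131/130]. -/
@[conjecture] def StairCellTS2a : Prop :=
  ∀ n p : ℕ, 1 ≤ n → p.Prime → 18 * n < p → p < 19 * n → casoratian (bRay ts2 n) 7 ≠ 0 →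
    (-2 : ℤ) ≤ padicValRat p (casoratian (bRay ts2 n) 7)

/-- **TS2b**: cell `(17,18)`, `c = −4` [M; 133/133]. -/
@[conjecture] def StairCellTS2b : Prop :=
  ∀ n p : ℕ, 1 ≤ n → p.Prime → 17 * n < p → p < 18 * n → casoratian (bRay ts2 n) 7 ≠ 0 →
    (-4 : ℤ) ≤ padicValRat p (casoratian (bRay ts2 n) 7)

/-- **TS3a**: cell `(36,38)`, `c = −3` [M; 233/232]. -/
@[conjecture] def StairCellTS3a : Prop :=
  ∀ n p : ℕ, 1 ≤ n → p.Prime → 36 * n < p → p < 38 * n → casoratian (bRay ts3 n) 7 ≠ 0 →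
    (-3 : ℤ) ≤ padicValRat p (casoratian (bRay ts3 n) 7)

/-- **TS3b**: cell `(35,36)`, `c = −4` [J = Lemma-D bonus, `casLB = −5`; 120/120]. -/
@[conjecture] def StairCellTS3b : Prop :=
  ∀ n p : ℕ, 1 ≤ n → p.Prime → 35 * n < p → p < 36 * n → casoratian (bRay ts3 n) 7 ≠ 0 →
    (-4 : ℤ) ≤ padicValRat p (casoratian (bRay ts3 n) 7)

/-- **TS4a**: cell `(24,25)`, `c = −2` [M; 119/118]. -/
@[conjecture] def StairCellTS4a : Prop :=
  ∀ n p : ℕ, 1 ≤ n → p.Prime → 24 * n < p → p < 25 * n → casoratian (bRay ts4 n) 7 ≠ 0 →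
    (-2 : ℤ) ≤ padicValRat p (casoratian (bRay ts4 n) 7)

/-- **TS4b**: cell `(23,24)`, `c = −3` [M; 129/129]. -/
@[conjecture] def StairCellTS4b : Prop :=
  ∀ n p : ℕ, 1 ≤ n → p.Prime → 23 * n < p → p < 24 * n → casoratian (bRay ts4 n) 7 ≠ 0 →
    (-3 : ℤ) ≤ padicValRat p (casoratian (bRay ts4 n) 7)

/-- **TS4c**: cell `(22,23)`, `c = −4` [J, `casLB = −5`; 127/127]. -/
@[conjecture] def StairCellTS4c : Prop :=
  ∀ n p : ℕ, 1 ≤ n → p.Prime → 22 * n < p → p < 23 * n → casoratian (bRay ts4 n) 7 ≠ 0 →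
    (-4 : ℤ) ≤ padicValRat p (casoratian (bRay ts4 n) 7)

/-- **TS5a**: cell `(22,23)`, `c = −3` [M; 127/127]. -/
@[conjecture] def StairCellTS5a : Prop :=
  ∀ n p : ℕ, 1 ≤ n → p.Prime → 22 * n < p → p < 23 * n → casoratian (bRay ts5 n) 7 ≠ 0 →
    (-3 : ℤ) ≤ padicValRat p (casoratian (bRay ts5 n) 7)

/-- **TS5b**: cell `(21,22)`, `c = −4` [J, `casLB = −5`; 129/128]. -/
@[conjecture] def StairCellTS5b : Prop :=
  ∀ n p : ℕ, 1 ≤ n → p.Prime → 21 * n < p → p < 22 * n → casoratian (bRay ts5 n) 7 ≠ 0 →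
    (-4 : ℤ) ≤ padicValRat p (casoratian (bRay ts5 n) 7)

/-- **TS6a**: cell `(23,24)`, `c = −3` [M; 129/129]. -/
@[conjecture] def StairCellTS6a : Prop :=
  ∀ n p : ℕ, 1 ≤ n → p.Prime → 23 * n < p → p < 24 * n → casoratian (bRay ts6 n) 7 ≠ 0 →
    (-3 : ℤ) ≤ padicValRat p (casoratian (bRay ts6 n) 7)

/-- **TS6b**: cell `(22,23)`, `c = −3` [B = double-drop bonus, `casLB = −5`, at 126 primes; M at 1; 127/127]. -/
@[conjecture] def StairCellTS6b : Prop :=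
  ∀ n p : ℕ, 1 ≤ n → p.Prime → 22 * n < p → p < 23 * n → casoratian (bRay ts6 n) 7 ≠ 0 →
    (-3 : ℤ) ≤ padicValRat p (casoratian (bRay ts6 n) 7)

/-- **TS7a**: cell `(36,38)`, `c = −3` [M; 233/232]. -/
@[conjecture] def StairCellTS7a : Prop :=
  ∀ n p : ℕ, 1 ≤ n → p.Prime → 36 * n < p → p < 38 * n → casoratian (bRay ts7 n) 7 ≠ 0 →
    (-3 : ℤ) ≤ padicValRat p (casoratian (bRay ts7 n) 7)

/-- **TS7b**: cell `(35,36)`, `c = −4` [J, `casLB = −5`; 120/120]. -/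
@[conjecture] def StairCellTS7b : Prop :=
  ∀ n p : ℕ, 1 ≤ n → p.Prime → 35 * n < p → p < 36 * n → casoratian (bRay ts7 n) 7 ≠ 0 →
    (-4 : ℤ) ≤ padicValRat p (casoratian (bRay ts7 n) 7)

/-- **TS7c**: cell `(34,35)`, `c = −5` [M; 119/119]. -/
@[conjecture] def StairCellTS7c : Prop :=
  ∀ n p : ℕ, 1 ≤ n → p.Prime → 34 * n < p → p < 35 * n → casoratian (bRay ts7 n) 7 ≠ 0 →
    (-5 : ℤ) ≤ padicValRat p (casoratian (bRay ts7 n) 7)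

/-- **TS8a**: cell `(18,19)`, `c = −3` [M; 131/131]. -/
@[conjecture] def StairCellTS8a : Prop :=
  ∀ n p : ℕ, 1 ≤ n → p.Prime → 18 * n < p → p < 19 * n → casoratian (bRay ts8 n) 7 ≠ 0 →
    (-3 : ℤ) ≤ padicValRat p (casoratian (bRay ts8 n) 7)

/-- **TS8b**: cell `(17,18)`, `c = −5` [M; 133/131]. -/
@[conjecture] def StairCellTS8b : Prop :=
  ∀ n p : ℕ, 1 ≤ n → p.Prime → 17 * n < p → p < 18 * n → casoratian (bRay ts8 n) 7 ≠ 0 →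
    (-5 : ℤ) ≤ padicValRat p (casoratian (bRay ts8 n) 7)

/-- **TS10a**: cell `(38,39)`, `c = −2` [M; 119/118]. -/
@[conjecture] def StairCellTS10a : Prop :=
  ∀ n p : ℕ, 1 ≤ n → p.Prime → 38 * n < p → p < 39 * n → casoratian (bRay ts10 n) 7 ≠ 0 →
    (-2 : ℤ) ≤ padicValRat p (casoratian (bRay ts10 n) 7)

/-- **TS10b**: cell `(36,38)`, `c = −3` [M; 233/233]. -/
@[conjecture] def StairCellTS10b : Prop :=
  ∀ n p : ℕ, 1 ≤ n → p.Prime → 36 * n < p → p < 38 * n → casoratian (bRay ts10 n) 7 ≠ 0 →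
    (-3 : ℤ) ≤ padicValRat p (casoratian (bRay ts10 n) 7)

/-- **TS10c**: cell `(35,36)`, `c = −5` [M; 120/120]. -/
@[conjecture] def StairCellTS10c : Prop :=
  ∀ n p : ℕ, 1 ≤ n → p.Prime → 35 * n < p → p < 36 * n → casoratian (bRay ts10 n) 7 ≠ 0 →
    (-5 : ℤ) ≤ padicValRat p (casoratian (bRay ts10 n) 7)

end Summit.KontsevichZagierPeriods.Zeta5Search.StaircaseCells
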